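import Literature.Computability.AlgebraicComplexity.MS21ANFBlockSupportCalculus
import HarnessLib

/-!
# Medini–Shpilka 2021, Lemma 5.12 (roanfMonInc) — the induction step on blocks

Theorem-only support file (cell `val-lit`, seat p1 g5; brick "5.12b" for `MS2021_thm_35`, owner
x5 g3) for [MediniShpilka2021, Lemma 5.12, arXiv:2102.05632 p0027:L40–p0028:L40].  On the product
index type `Fin 4 × τ`, for the block polynomial `B = A⁽⁰⁾A⁽¹⁾ + A⁽²⁾A⁽³⁾` of an abstract
multilinear homogeneous `A` (later `A = ANF_{Δ+1}`, `B ≅ ANF_{Δ+2}`), we prove the induction step of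
the TR-free form of Lemma 5.12: if `mon(B(Mx)) ⊆ mon(B)` for an invertible `M` and the statement
holds for `A`, then `B(Mx) = B(α • x)` for nonzero scalars `α`.  Route (a re-organisation of the
printed proof p0028:L7–L40, whose "WLOG"/`TR` steps become explicit block bijections): the two
products `g₁g₂`, `g₃g₄` of `B(Mx)` live on opposite sides of the top addition gate (the printed
"`var(g₁g₂) ∩ var(g₃g₄) = ∅` … `mon(g₁g₂) ⊆ mon(F₁F₂)`", here by a no-cancellation/rectangle
argument on supports), the rows of `M` follow, each factor `g_i` lives in one block (the printed
`p₁,…,p₄` paragraph, here: block-weights of the monomials of `g₁`, `g₂` are constant, and a mixed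
weight would confine all variables to one half of a block), so `M` is block-monomial, the diagonal
blocks are invertible, and the hypothesis for `A` applies blockwise.  No definitions, no named
facts; nothing here bears on `VP ≠ VNP`.

## References
* [MediniShpilka2021] arXiv:2102.05632, Lemma 5.12 (p0027:L40) and its proof (p0028:L7–L40),
  Obs. 2.7, Obs. 5.7–5.8, Cor. 5.10.
-/

noncomputable section

open MvPolynomial Finset Matrix

namespace Literature.Computability.AlgebraicComplexity

namespace MS2021

variable {K : Type*} [Field K] {τ : Type*} [Fintype τ] [DecidableEq τ]

/-! ### No cancellation between the two products; sides -/

/-- Every variable occurs in `B(Mx)` (`M` invertible, first partials of `B` independent).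
[cite: MediniShpilka2021, proof of Lemma 5.12 (arXiv p0028:L10-L12: "`var(g) = var(ANF)`")] -/
theorem mem_vars_aeval_linSubst_of_indep {B : MvPolynomial (Fin 4 × τ) K}
    (hBind : ∀ u : Fin 4 × τ → K, u ≠ 0 → (∑ v, C (u v) * pderiv v B) ≠ 0)
    (M : Matrix (Fin 4 × τ) (Fin 4 × τ) K) (hM : IsUnit M.det) (y : Fin 4 × τ) :
    y ∈ (aeval (fun v : Fin 4 × τ => ∑ w, C (M v w) * X w) B).vars := by
  by_contra hy
  have h0 := pderiv_eq_zero_of_notMem_vars hy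
  rw [pderiv_aeval_linSubst (fun v w => M v w) y B,
    ← map_zero (aeval (fun v : Fin 4 × τ => ∑ w, C (M v w) * X w) :
      MvPolynomial (Fin 4 × τ) K →ₐ[K] MvPolynomial (Fin 4 × τ) K)] at h0
  exact hBind _ (col_ne_zero_of_isUnit_det hM y) (aeval_linSubst_injective M hM h0)

/-- **No cancellation between `g₁g₂` and `g₃g₄`**: under the column dichotomy, the monomials of
`(A⁽ᵇ⁾A⁽ᵇ'⁾)(Mx)` are monomials of `B(Mx)`, hence of `B`.
[cite: MediniShpilka2021, proof of Lemma 5.12 (arXiv p0028:L19: "in particular `mon(g₁g₂), mon(g₃g₄) ⊆ mon(ANF)`")] -/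
theorem support_aeval_linSubst_mul_subset (A : MvPolynomial τ K) {d : ℕ} (hAd : A.IsHomogeneous d)
    (hd : 2 ≤ d) (hA1 : ∀ j, degreeOf j A ≤ 1)
    (hAsib : ∀ j : τ, ∃ j' : τ, j' ≠ j ∧ ∀ μ ∈ A.support, μ j ≠ 0 → μ j' ≠ 0)
    {B : MvPolynomial (Fin 4 × τ) K}
    (hB : B = rename (Prod.mk (0 : Fin 4)) A * rename (Prod.mk (1 : Fin 4)) A +
      rename (Prod.mk (2 : Fin 4)) A * rename (Prod.mk (3 : Fin 4)) A)
    (hBind : ∀ u : Fin 4 × τ → K, u ≠ 0 → (∑ v, C (u v) * pderiv v B) ≠ 0)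
    (M : Matrix (Fin 4 × τ) (Fin 4 × τ) K) (hM : IsUnit M.det)
    (hsupp : (aeval (fun v : Fin 4 × τ => ∑ w, C (M v w) * X w) B).support ⊆ B.support)
    {b b' : Fin 4} (hbb' : (b = 0 ∧ b' = 1) ∨ (b = 2 ∧ b' = 3)) :
    (aeval (fun v : Fin 4 × τ => ∑ w, C (M v w) * X w)
        (rename (Prod.mk b) A * rename (Prod.mk b') A)).support ⊆ B.support := by
  set θ := (aeval (fun v : Fin 4 × τ => ∑ w, C (M v w) * X w) :
    MvPolynomial (Fin 4 × τ) K →ₐ[K] MvPolynomial (Fin 4 × τ) K) with hθ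
  set P := rename (Prod.mk (0 : Fin 4)) A * rename (Prod.mk (1 : Fin 4)) A with hP
  set Q := rename (Prod.mk (2 : Fin 4)) A * rename (Prod.mk (3 : Fin 4)) A with hQ
  -- the column dichotomy
  have hcol := col_low_or_high A hAd hd hA1 hAsib (hB ▸ hBind) M hM (hB ▸ hsupp)
  -- a common monomial of `θ P` and `θ Q` is impossible
  have hPQ : ∀ m, m ∈ (θ P).support → m ∈ (θ Q).support → False := by
    intro m hmP hmQ
    have hPhom : (θ P).IsHomogeneous (d + d) :=
      isHomogeneous_aeval_linSubst M ((hAd.rename_isHomogeneous).mul hAd.rename_isHomogeneous)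
    have hm0 : m ≠ 0 := by
      rintro rfl
      refine mem_support_iff.1 hmP (hPhom.coeff_eq_zero ?_)
      rw [map_zero]; omega
    obtain ⟨y, hy⟩ := Finsupp.ne_iff.1 hm0
    have hyP : y ∈ (θ P).vars := (mem_vars_iff_mem_support y).2 ⟨m, hmP, Finsupp.mem_support_iff.2 hy⟩
    have hyQ : y ∈ (θ Q).vars := (mem_vars_iff_mem_support y).2 ⟨m, hmQ, Finsupp.mem_support_iff.2 hy⟩
    obtain ⟨v, hv, hvy⟩ := exists_ne_zero_of_mem_vars_aeval_linSubst M P hyP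
    obtain ⟨v', hv', hv'y⟩ := exists_ne_zero_of_mem_vars_aeval_linSubst M Q hyQ
    have hvlow : (v.1 : ℕ) < 2 := by
      rcases fst_eq_or_of_mem_vars_rename_mul A 0 1 hv with h | h <;> (rw [h]; decide)
    have hv'high : ¬ (v'.1 : ℕ) < 2 := by
      rcases fst_eq_or_of_mem_vars_rename_mul A 2 3 hv' with h | h <;> (rw [h]; decide)
    rcases hcol y with h | h
    · exact hv'y (h v' hv'high)
    · exact hvy (h v hvlow)
  have hθB : θ B = θ P + θ Q := by rw [hB, map_add]
  intro m hm
  rcases hbb' with ⟨rfl, rfl⟩ | ⟨rfl, rfl⟩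
  · apply hsupp
    rw [mem_support_iff, hθB, coeff_add]
    have hq : coeff m (θ Q) = 0 := by
      by_contra h
      exact hPQ m hm (mem_support_iff.2 h)
    rw [hq, add_zero]
    exact mem_support_iff.1 hm
  · apply hsupp
    rw [mem_support_iff, hθB, coeff_add]
    have hp : coeff m (θ P) = 0 := by
      by_contra h
      exact hPQ m (mem_support_iff.2 h) hm
    rw [hp, zero_add]
    exact mem_support_iff.1 hm

/-- Blocks `0, 1` are the blocks `b` with `b < 2`; blocks `2, 3` the others. [cite: MediniShpilka2021, Def 8] -/
private theorem fin4_lt_two_iff (b : Fin 4) : (b : ℕ) < 2 ↔ (b = 0 ∨ b = 1 - 0) := by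
  fin_cases b <;> decide

/-- Blocks `2, 3` are the blocks `b` with `¬ b < 2`. [cite: MediniShpilka2021, Def 8] -/
private theorem fin4_not_lt_two_iff (b : Fin 4) : ¬ (b : ℕ) < 2 ↔ (b = 2 ∨ b = 1 - 2) := by
  fin_cases b <;> decide

/-- **Sides** (the rectangle argument): if `P₀·P₁` (variable-disjoint, homogeneous of positive
degree) has all its monomials among those of `B`, then all variables of `P₀` and `P₁` lie on one
side `{s, 1-s}`, `s ∈ {0, 2}`, of the top addition gate — a monomial of `B` lies on one side, and
the side of `μ + ν` is read off from any variable of `μ` or of `ν`.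
[cite: MediniShpilka2021, proof of Lemma 5.12 (arXiv p0028:L20-L24: "`mon(g₁g₂) ⊆ mon(F₁F₂)`")] -/
theorem exists_side_of_support_mul_subset (A : MvPolynomial τ K) {B : MvPolynomial (Fin 4 × τ) K}
    (hB : B = rename (Prod.mk (0 : Fin 4)) A * rename (Prod.mk (1 : Fin 4)) A +
      rename (Prod.mk (2 : Fin 4)) A * rename (Prod.mk (3 : Fin 4)) A)
    {P₀ P₁ : MvPolynomial (Fin 4 × τ) K} {d : ℕ} (hd : d ≠ 0) (h₀ : P₀.IsHomogeneous d)
    (h₁ : P₁.IsHomogeneous d) (hP₀ : P₀ ≠ 0) (hP₁ : P₁ ≠ 0) (hdisj : Disjoint P₀.vars P₁.vars)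
    (hsub : (P₀ * P₁).support ⊆ B.support) :
    ∃ s : Fin 4, (s = 0 ∨ s = 2) ∧ ∀ y ∈ P₀.vars ∪ P₁.vars, y.1 = s ∨ y.1 = 1 - s := by
  -- every pair of monomials gives a monomial of `B`
  have hpair : ∀ μ ∈ P₀.support, ∀ ν ∈ P₁.support, μ + ν ∈ B.support := fun μ hμ ν hν =>
    hsub ((mem_support_mul_iff_of_vars_subset (Finset.Subset.refl _)
      (fun i hi hi' => Finset.disjoint_left.1 hdisj hi' hi) _).2 ⟨μ, hμ, ν, hν, rfl⟩)
  -- all variables of `μ + ν` lie on one side, read off by `lowness`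
  have hside : ∀ μ ∈ P₀.support, ∀ ν ∈ P₁.support, ∀ w w' : Fin 4 × τ,
      (μ + ν) w ≠ 0 → (μ + ν) w' ≠ 0 → ((w.1 : ℕ) < 2 ↔ (w'.1 : ℕ) < 2) := by
    intro μ hμ ν hν w w' hw hw'
    obtain ⟨b₀, hb₀, μ', -, ν', -, hdec⟩ := exists_decomp_of_mem_support_block A (hB ▸ hpair μ hμ ν hν)
    have key : ∀ x : Fin 4 × τ, (μ + ν) x ≠ 0 → (x.1 = b₀ ∨ x.1 = 1 - b₀) := by
      rintro ⟨b, j⟩ hx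
      rw [hdec, mapDomain_mk_add_apply (one_sub_ne_self b₀).symm] at hx
      by_contra hcon
      rw [not_or] at hcon
      rw [if_neg hcon.1, if_neg hcon.2, add_zero] at hx
      exact hx rfl
    have hb : ∀ x : Fin 4 × τ, (μ + ν) x ≠ 0 → ((x.1 : ℕ) < 2 ↔ b₀ = 0) := by
      intro x hx
      rcases hb₀ with rfl | rfl
      · rw [fin4_lt_two_iff]; exact iff_of_true (key x hx) rfl
      · rw [← not_iff_not, fin4_not_lt_two_iff]; exact iff_of_true (key x hx) (by decide)
    rw [hb w hw, hb w' hw']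
  -- monomials are nonzero
  have hvar₀ : ∀ μ ∈ P₀.support, ∃ w, μ w ≠ 0 := by
    intro μ hμ
    by_contra h
    push Not at h
    have : μ = 0 := Finsupp.ext h
    subst this
    exact mem_support_iff.1 hμ (h₀.coeff_eq_zero (by rw [map_zero]; exact hd.symm))
  have hvar₁ : ∀ ν ∈ P₁.support, ∃ w, ν w ≠ 0 := by
    intro ν hν
    by_contra h
    push Not at h
    have : ν = 0 := Finsupp.ext h
    subst this
    exact mem_support_iff.1 hν (h₁.coeff_eq_zero (by rw [map_zero]; exact hd.symm))
  have hμν : ∀ μ ν : Fin 4 × τ →₀ ℕ, ∀ w, μ w ≠ 0 → (μ + ν) w ≠ 0 := fun μ ν w hw => by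
    rw [Finsupp.add_apply]; omega
  have hνμ : ∀ μ ν : Fin 4 × τ →₀ ℕ, ∀ w, ν w ≠ 0 → (μ + ν) w ≠ 0 := fun μ ν w hw => by
    rw [Finsupp.add_apply]; omega
  -- reference monomials
  obtain ⟨ν₁, hν₁⟩ := Finset.nonempty_of_ne_empty (mt support_eq_empty.1 hP₁)
  obtain ⟨w₁, hw₁⟩ := hvar₁ ν₁ hν₁
  obtain ⟨μ₁, hμ₁⟩ := Finset.nonempty_of_ne_empty (mt support_eq_empty.1 hP₀)
  obtain ⟨w₀, hw₀⟩ := hvar₀ μ₁ hμ₁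
  have H₀ : ∀ μ ∈ P₀.support, ∀ w, μ w ≠ 0 → ((w.1 : ℕ) < 2 ↔ (w₁.1 : ℕ) < 2) :=
    fun μ hμ w hw => hside μ hμ ν₁ hν₁ w w₁ (hμν μ ν₁ w hw) (hνμ μ ν₁ w₁ hw₁)
  have H₁ : ∀ ν ∈ P₁.support, ∀ w, ν w ≠ 0 → ((w.1 : ℕ) < 2 ↔ (w₁.1 : ℕ) < 2) :=
    fun ν hν w hw => (hside μ₁ hμ₁ ν hν w₀ w (hμν μ₁ ν w₀ hw₀) (hνμ μ₁ ν w hw)).symm.trans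
      (H₀ μ₁ hμ₁ w₀ hw₀)
  by_cases hL : (w₁.1 : ℕ) < 2
  · refine ⟨0, Or.inl rfl, fun y hy => ?_⟩
    rw [← fin4_lt_two_iff]
    rcases Finset.mem_union.1 hy with hy | hy
    · obtain ⟨μ, hμ, hyμ⟩ := (mem_vars_iff_mem_support y).1 hy
      exact (H₀ μ hμ y (Finsupp.mem_support_iff.1 hyμ)).2 hL
    · obtain ⟨ν, hν, hyν⟩ := (mem_vars_iff_mem_support y).1 hy
      exact (H₁ ν hν y (Finsupp.mem_support_iff.1 hyν)).2 hL
  · refine ⟨2, Or.inr rfl, fun y hy => ?_⟩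
    rw [← fin4_not_lt_two_iff]
    rcases Finset.mem_union.1 hy with hy | hy
    · obtain ⟨μ, hμ, hyμ⟩ := (mem_vars_iff_mem_support y).1 hy
      exact fun h => hL ((H₀ μ hμ y (Finsupp.mem_support_iff.1 hyμ)).1 h)
    · obtain ⟨ν, hν, hyν⟩ := (mem_vars_iff_mem_support y).1 hy
      exact fun h => hL ((H₁ ν hν y (Finsupp.mem_support_iff.1 hyν)).1 h)

/-- **Rows follow the sides**: if all variables of `(A⁽⁰⁾A⁽¹⁾)(Mx)` lie in the blocks `{s, 1-s}`,
then the rows of `M` in blocks `0, 1` vanish outside the columns of blocks `{s, 1-s}` (chain rule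
and independence of the first partials of `B`). Same for `A⁽²⁾A⁽³⁾` and the rows of blocks `2, 3`.
[cite: MediniShpilka2021, proof of Lemma 5.12 (arXiv p0028:L22-L24: "`var(g₁g₂) = var(F₁F₂)`")] -/
theorem row_eq_zero_of_vars_subset_side (A : MvPolynomial τ K) {B : MvPolynomial (Fin 4 × τ) K}
    (hB : B = rename (Prod.mk (0 : Fin 4)) A * rename (Prod.mk (1 : Fin 4)) A +
      rename (Prod.mk (2 : Fin 4)) A * rename (Prod.mk (3 : Fin 4)) A)
    (hBind : ∀ u : Fin 4 × τ → K, u ≠ 0 → (∑ v, C (u v) * pderiv v B) ≠ 0)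
    (M : Matrix (Fin 4 × τ) (Fin 4 × τ) K) (hM : IsUnit M.det) {b b' : Fin 4}
    (hbb' : (b = 0 ∧ b' = 1) ∨ (b = 2 ∧ b' = 3)) {s : Fin 4}
    (hvars : ∀ y ∈ (aeval (fun v : Fin 4 × τ => ∑ w, C (M v w) * X w)
      (rename (Prod.mk b) A * rename (Prod.mk b') A)).vars, y.1 = s ∨ y.1 = 1 - s)
    (v y : Fin 4 × τ) (hv : v.1 = b ∨ v.1 = b') (hy : ¬ (y.1 = s ∨ y.1 = 1 - s)) : M v y = 0 := by
  set θ := (aeval (fun v : Fin 4 × τ => ∑ w, C (M v w) * X w) :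
    MvPolynomial (Fin 4 × τ) K →ₐ[K] MvPolynomial (Fin 4 × τ) K) with hθ
  set P := rename (Prod.mk b) A * rename (Prod.mk b') A with hP
  have hy' : y ∉ (θ P).vars := fun h => hy (hvars y h)
  have h0 := pderiv_eq_zero_of_notMem_vars hy'
  rw [pderiv_aeval_linSubst (fun v w => M v w) y P,
    ← map_zero (aeval (fun v : Fin 4 × τ => ∑ w, C (M v w) * X w) :
      MvPolynomial (Fin 4 × τ) K →ₐ[K] MvPolynomial (Fin 4 × τ) K)] at h0
  have h1 : (∑ v, C (M v y) * pderiv v P) = 0 := aeval_linSubst_injective M hM h0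
  rcases hbb' with ⟨rfl, rfl⟩ | ⟨rfl, rfl⟩
  · -- rows of blocks `0, 1`
    set uL : Fin 4 × τ → K := fun v => if (v.1 : ℕ) < 2 then M v y else 0 with huL
    have h2 : (∑ v, C (uL v) * pderiv v B) = 0 := by
      rw [hB, sum_C_mul_pderiv_block_split A uL]
      have e1 : (∑ v, C (if (v.1 : ℕ) < 2 then uL v else 0) * pderiv v P) =
          ∑ v, C (M v y) * pderiv v P := by
        rw [← sum_C_ite_mul_pderiv_low A (fun v => M v y)]
        refine Finset.sum_congr rfl fun v _ => ?_
        simp only [huL]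
        split_ifs <;> rfl
      have e2 : (∑ v, C (if (v.1 : ℕ) < 2 then (0 : K) else uL v) *
          pderiv v (rename (Prod.mk (2 : Fin 4)) A * rename (Prod.mk (3 : Fin 4)) A)) = 0 := by
        refine Finset.sum_eq_zero fun v _ => ?_
        simp only [huL]
        split_ifs <;> simp
      rw [e1, e2, h1, add_zero]
    have hz : uL = 0 := by
      by_contra h
      exact hBind uL h h2
    have hvlow : (v.1 : ℕ) < 2 := by rcases hv with h | h <;> (rw [h]; decide)
    have := congrFun hz v
    simp only [huL, if_pos hvlow, Pi.zero_apply] at this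
    exact this
  · -- rows of blocks `2, 3`
    set uH : Fin 4 × τ → K := fun v => if (v.1 : ℕ) < 2 then 0 else M v y with huH
    have h2 : (∑ v, C (uH v) * pderiv v B) = 0 := by
      rw [hB, sum_C_mul_pderiv_block_split A uH]
      have e1 : (∑ v, C (if (v.1 : ℕ) < 2 then (0 : K) else uH v) * pderiv v P) =
          ∑ v, C (M v y) * pderiv v P := by
        rw [← sum_C_ite_mul_pderiv_high A (fun v => M v y)]
        refine Finset.sum_congr rfl fun v _ => ?_
        simp only [huH]
        split_ifs <;> rfl
      have e2 : (∑ v, C (if (v.1 : ℕ) < 2 then uH v else 0) *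
          pderiv v (rename (Prod.mk (0 : Fin 4)) A * rename (Prod.mk (1 : Fin 4)) A)) = 0 := by
        refine Finset.sum_eq_zero fun v _ => ?_
        simp only [huH]
        split_ifs <;> simp
      rw [e1, e2, h1, zero_add]
    have hz : uH = 0 := by
      by_contra h
      exact hBind uH h h2
    have hvhigh : ¬ (v.1 : ℕ) < 2 := by rcases hv with h | h <;> (rw [h]; decide)
    have := congrFun hz v
    simp only [huH, if_neg hvhigh, Pi.zero_apply] at this
    exact this

/-! ### Each factor lives in one block -/

omit [DecidableEq τ] in
/-- Degree of a monomial on `Fin 4 × τ` as a sum of its four block weights. [cite: MediniShpilka2021, proof of Lemma 5.12 (arXiv p0028:L7-L40), book-keeping] -/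
theorem degree_eq_sum_blocks (μ : Fin 4 × τ →₀ ℕ) :
    μ.degree = ∑ b : Fin 4, ∑ j : τ, μ (b, j) := by
  rw [Finsupp.degree_eq_sum, Fintype.sum_prod_type]

omit [DecidableEq τ] in
/-- Block weight of a two-block monomial. [cite: MediniShpilka2021, proof of Lemma 5.12 (arXiv p0028:L7-L40), book-keeping] -/
theorem sum_mapDomain_mk_add_apply {s : Fin 4} (μ' ν' : τ →₀ ℕ) (b : Fin 4) :
    (∑ j : τ, (Finsupp.mapDomain (Prod.mk s) μ' + Finsupp.mapDomain (Prod.mk (1 - s)) ν') (b, j)) =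
      (if b = s then μ'.degree else 0) + (if b = 1 - s then ν'.degree else 0) := by
  simp_rw [mapDomain_mk_add_apply (one_sub_ne_self s).symm μ' ν' b]
  rw [Finset.sum_add_distrib]
  congr 1
  · split_ifs
    · rw [Finsupp.degree_eq_sum]
    · simp
  · split_ifs
    · rw [Finsupp.degree_eq_sum]
    · simp

/-- **Each factor lives in one block** (the `p₁, …, p₄` paragraph of the printed proof, here via
block weights): if `P₀ · P₁` (variable-disjoint, both homogeneous of degree `d = deg A ≥ 2`) has
all its monomials among those of `B`, all its variables in the blocks `{s, 1-s}`, and every variable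
of these two blocks occurs, then `P₀` lives in one of the two blocks and `P₁` in the other.  The
weights `w_s(μ)` (`μ ∈ mon P₀`) are constant since `w_s(μ) + w_s(ν) = d`; a constant strictly
between `0` and `d` would put all block-`s` variables of `P₀P₁` into one half of block `s`
(the monomials of `A` live in one half), contradicting that every variable occurs.
[cite: MediniShpilka2021, proof of Lemma 5.12 (arXiv p0028:L25-L37)] -/
theorem exists_block_of_support_mul_subset (A : MvPolynomial τ K) {d : ℕ} (hAd : A.IsHomogeneous d)
    (hd : 2 ≤ d) (H : τ → Bool)
    (hH : ∀ μ ∈ A.support, ∀ j j', μ j ≠ 0 → μ j' ≠ 0 → H j = H j')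
    (hHt : ∃ j, H j = true) (hHf : ∃ j, H j = false)
    {B : MvPolynomial (Fin 4 × τ) K}
    (hB : B = rename (Prod.mk (0 : Fin 4)) A * rename (Prod.mk (1 : Fin 4)) A +
      rename (Prod.mk (2 : Fin 4)) A * rename (Prod.mk (3 : Fin 4)) A)
    {P₀ P₁ : MvPolynomial (Fin 4 × τ) K} (h₀ : P₀.IsHomogeneous d) (h₁ : P₁.IsHomogeneous d)
    (hP₀ : P₀ ≠ 0) (hP₁ : P₁ ≠ 0) (hdisj : Disjoint P₀.vars P₁.vars)
    (hsub : (P₀ * P₁).support ⊆ B.support) {s : Fin 4}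
    (hvars : ∀ y ∈ P₀.vars ∪ P₁.vars, y.1 = s ∨ y.1 = 1 - s)
    (hcover : ∀ y : Fin 4 × τ, (y.1 = s ∨ y.1 = 1 - s) → y ∈ P₀.vars ∪ P₁.vars) :
    ∃ c : Fin 4, (c = s ∨ c = 1 - s) ∧ (∀ μ ∈ P₀.support, ∀ w, μ w ≠ 0 → w.1 = c) ∧
      (∀ ν ∈ P₁.support, ∀ w, ν w ≠ 0 → w.1 = 1 - c) := by
  have hd0 : d ≠ 0 := by omega
  -- pairs of monomials are monomials of `B`, decomposed along block `s`
  have hpair : ∀ μ ∈ P₀.support, ∀ ν ∈ P₁.support, μ + ν ∈ B.support := fun μ hμ ν hν =>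
    hsub ((mem_support_mul_iff_of_vars_subset (Finset.Subset.refl _)
      (fun i hi hi' => Finset.disjoint_left.1 hdisj hi' hi) _).2 ⟨μ, hμ, ν, hν, rfl⟩)
  have hvar₀ : ∀ μ ∈ P₀.support, ∀ w, μ w ≠ 0 → (w.1 = s ∨ w.1 = 1 - s) := fun μ hμ w hw =>
    hvars w (Finset.mem_union_left _ ((mem_vars_iff_mem_support w).2 ⟨μ, hμ, Finsupp.mem_support_iff.2 hw⟩))
  have hvar₁ : ∀ ν ∈ P₁.support, ∀ w, ν w ≠ 0 → (w.1 = s ∨ w.1 = 1 - s) := fun ν hν w hw =>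
    hvars w (Finset.mem_union_right _ ((mem_vars_iff_mem_support w).2 ⟨ν, hν, Finsupp.mem_support_iff.2 hw⟩))
  have hdeg₀ : ∀ μ ∈ P₀.support, μ.degree = d := fun μ hμ => by
    by_contra h; exact mem_support_iff.1 hμ (h₀.coeff_eq_zero h)
  have hdeg₁ : ∀ ν ∈ P₁.support, ν.degree = d := fun ν hν => by
    by_contra h; exact mem_support_iff.1 hν (h₁.coeff_eq_zero h)
  have hdec : ∀ μ ∈ P₀.support, ∀ ν ∈ P₁.support, ∃ μ' ∈ A.support, ∃ ν' ∈ A.support,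
      μ + ν = Finsupp.mapDomain (Prod.mk s) μ' + Finsupp.mapDomain (Prod.mk (1 - s)) ν' := by
    intro μ hμ ν hν
    have hm := hpair μ hμ ν hν
    rw [hB] at hm
    obtain ⟨b₀, -, μ', hμ', ν', hν', hmeq⟩ := exists_decomp_of_mem_support_block A hm
    -- `μ'` is nonzero, so `μ + ν` has a variable in block `b₀`, which is `s` or `1 - s`
    have hμ'0 : μ' ≠ 0 := by
      rintro rfl
      refine mem_support_iff.1 hμ' (hAd.coeff_eq_zero ?_)
      rw [map_zero]; exact hd0.symm
    obtain ⟨j, hj⟩ := Finsupp.ne_iff.1 hμ'0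
    have hbj : (μ + ν) (b₀, j) ≠ 0 := by
      rw [hmeq, mapDomain_mk_add_apply (one_sub_ne_self b₀).symm, if_pos rfl,
        if_neg (one_sub_ne_self b₀).symm, add_zero]
      exact hj
    have hb₀ : b₀ = s ∨ b₀ = 1 - s := by
      have : μ (b₀, j) ≠ 0 ∨ ν (b₀, j) ≠ 0 := by
        rw [Finsupp.add_apply] at hbj; omega
      rcases this with h | h
      · exact hvar₀ μ hμ _ h
      · exact hvar₁ ν hν _ h
    have hsj : ∃ j₀, (μ + ν) (s, j₀) ≠ 0 := by
      rcases hb₀ with rfl | hb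
      · exact ⟨j, hbj⟩
      · -- `1 - b₀ = s`: use a variable of `ν'`
        have hν'0 : ν' ≠ 0 := by
          rintro rfl
          refine mem_support_iff.1 hν' (hAd.coeff_eq_zero ?_)
          rw [map_zero]; exact hd0.symm
        obtain ⟨j', hj'⟩ := Finsupp.ne_iff.1 hν'0
        refine ⟨j', ?_⟩
        have hs : s = 1 - b₀ := by rw [hb, sub_sub_cancel]
        rw [hs, hmeq, mapDomain_mk_add_apply (one_sub_ne_self b₀).symm,
          if_neg (one_sub_ne_self b₀), if_pos rfl]
        simpa using hj'
    obtain ⟨j₀, hj₀⟩ := hsj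
    exact exists_decomp_of_mem_support_block_of_ne_zero A hm hj₀
  -- block weights
  have hW : ∀ μ ∈ P₀.support, ∀ ν ∈ P₁.support,
      (∑ j, μ (s, j)) + (∑ j, ν (s, j)) = d ∧ (∑ j, μ (1 - s, j)) + (∑ j, ν (1 - s, j)) = d := by
    intro μ hμ ν hν
    obtain ⟨μ', hμ', ν', hν', hmeq⟩ := hdec μ hμ ν hν
    have hdμ' : μ'.degree = d := by
      by_contra h; exact mem_support_iff.1 hμ' (hAd.coeff_eq_zero h)
    have hdν' : ν'.degree = d := by
      by_contra h; exact mem_support_iff.1 hν' (hAd.coeff_eq_zero h)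
    have e1 := sum_mapDomain_mk_add_apply (s := s) μ' ν' s
    have e2 := sum_mapDomain_mk_add_apply (s := s) μ' ν' (1 - s)
    rw [← hmeq, if_pos rfl, if_neg (one_sub_ne_self s).symm, add_zero, hdμ'] at e1
    rw [← hmeq, if_neg (one_sub_ne_self s), if_pos rfl, zero_add, hdν'] at e2
    simp_rw [Finsupp.add_apply, Finset.sum_add_distrib] at e1 e2
    exact ⟨e1, e2⟩
  -- degree of a monomial supported in blocks `s, 1-s`
  have hdegsplit : ∀ μ : Fin 4 × τ →₀ ℕ, (∀ w, μ w ≠ 0 → (w.1 = s ∨ w.1 = 1 - s)) →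
      μ.degree = (∑ j, μ (s, j)) + ∑ j, μ (1 - s, j) := by
    intro μ hμ
    rw [degree_eq_sum_blocks]
    rw [Fintype.sum_eq_add s (1 - s) (one_sub_ne_self s).symm]
    rintro b ⟨hb, hb'⟩
    refine Finset.sum_eq_zero fun j _ => ?_
    by_contra h
    rcases hμ (b, j) h with h' | h'
    · exact hb h'
    · exact hb' h'
  obtain ⟨μ₁, hμ₁⟩ := Finset.nonempty_of_ne_empty (mt support_eq_empty.1 hP₀)
  obtain ⟨ν₁, hν₁⟩ := Finset.nonempty_of_ne_empty (mt support_eq_empty.1 hP₁)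
  set a₀ := ∑ j, μ₁ (s, j) with ha₀
  have hWν : ∀ ν ∈ P₁.support, (∑ j, ν (s, j)) = d - a₀ := fun ν hν => by
    have := (hW μ₁ hμ₁ ν hν).1; omega
  have hWμ : ∀ μ ∈ P₀.support, (∑ j, μ (s, j)) = a₀ := fun μ hμ => by
    have h1 := (hW μ hμ ν₁ hν₁).1
    have h2 := hWν ν₁ hν₁
    have h3 := (hW μ₁ hμ₁ ν₁ hν₁).1
    omega
  have ha₀d : a₀ ≤ d := by have := (hW μ₁ hμ₁ ν₁ hν₁).1; omega
  -- helper: a block weight `0` means no variable in that block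
  have hzero : ∀ (μ : Fin 4 × τ →₀ ℕ) (b : Fin 4), (∑ j, μ (b, j)) = 0 → ∀ j, μ (b, j) = 0 :=
    fun μ b h j => (Finset.sum_eq_zero_iff.1 h) j (Finset.mem_univ j)
  by_cases hA : a₀ = d
  · -- `P₀` lives in block `s`, `P₁` in block `1 - s`
    refine ⟨s, Or.inl rfl, fun μ hμ w hw => ?_, fun ν hν w hw => ?_⟩
    · have h1 := hdegsplit μ (hvar₀ μ hμ)
      rw [hdeg₀ μ hμ, hWμ μ hμ, hA] at h1
      have h2 : (∑ j, μ (1 - s, j)) = 0 := by omega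
      rcases hvar₀ μ hμ w hw with h | h
      · exact h
      · exfalso; apply hw
        have := hzero μ (1 - s) h2 w.2
        rwa [← h] at this
    · have h2 : (∑ j, ν (s, j)) = 0 := by rw [hWν ν hν, hA]; simp
      rcases hvar₁ ν hν w hw with h | h
      · exfalso; apply hw
        have := hzero ν s h2 w.2
        rwa [← h] at this
      · exact h
  by_cases hA0 : a₀ = 0
  · -- `P₀` lives in block `1 - s`, `P₁` in block `s`
    refine ⟨1 - s, Or.inr rfl, fun μ hμ w hw => ?_, fun ν hν w hw => ?_⟩
    · have h2 : (∑ j, μ (s, j)) = 0 := by rw [hWμ μ hμ, hA0]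
      rcases hvar₀ μ hμ w hw with h | h
      · exfalso; apply hw
        have := hzero μ s h2 w.2
        rwa [← h] at this
      · exact h
    · rw [sub_sub_cancel]
      have h1 := hdegsplit ν (hvar₁ ν hν)
      rw [hdeg₁ ν hν, hWν ν hν, hA0] at h1
      have h2 : (∑ j, ν (1 - s, j)) = 0 := by omega
      rcases hvar₁ ν hν w hw with h | h
      · exact h
      · exfalso; apply hw
        have := hzero ν (1 - s) h2 w.2
        rwa [← h] at this
  · -- `0 < a₀ < d`: all block-`s` variables would lie in one half of block `s`
    exfalso
    have hsame : ∀ μ ∈ P₀.support, ∀ ν ∈ P₁.support, ∀ j j',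
        μ (s, j) ≠ 0 → ν (s, j') ≠ 0 → H j = H j' := by
      intro μ hμ ν hν j j' hj hj'
      obtain ⟨μ', hμ', ν', -, hmeq⟩ := hdec μ hμ ν hν
      have ev : ∀ i, (μ + ν) (s, i) = μ' i := fun i => by
        rw [hmeq, mapDomain_mk_add_apply (one_sub_ne_self s).symm, if_pos rfl,
          if_neg (one_sub_ne_self s).symm, add_zero]
      refine hH μ' hμ' j j' ?_ ?_
      · rw [← ev, Finsupp.add_apply]; omega
      · rw [← ev, Finsupp.add_apply]; omega
    have hexμ : ∀ μ ∈ P₀.support, ∃ j, μ (s, j) ≠ 0 := fun μ hμ => by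
      by_contra h
      push Not at h
      have : (∑ j, μ (s, j)) = 0 := Finset.sum_eq_zero fun j _ => h j
      rw [hWμ μ hμ] at this
      exact hA0 this
    have hexν : ∀ ν ∈ P₁.support, ∃ j, ν (s, j) ≠ 0 := fun ν hν => by
      by_contra h
      push Not at h
      have : (∑ j, ν (s, j)) = 0 := Finset.sum_eq_zero fun j _ => h j
      rw [hWν ν hν] at this
      omega
    obtain ⟨j₁, hj₁⟩ := hexν ν₁ hν₁
    obtain ⟨j₀, hj₀⟩ := hexμ μ₁ hμ₁
    have Hμ : ∀ μ ∈ P₀.support, ∀ j, μ (s, j) ≠ 0 → H j = H j₁ :=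
      fun μ hμ j hj => hsame μ hμ ν₁ hν₁ j j₁ hj hj₁
    have Hν : ∀ ν ∈ P₁.support, ∀ j, ν (s, j) ≠ 0 → H j = H j₁ :=
      fun ν hν j hj => (hsame μ₁ hμ₁ ν hν j₀ j hj₀ hj).symm.trans (Hμ μ₁ hμ₁ j₀ hj₀)
    -- a position `j*` in the other half
    obtain ⟨jt, hjt⟩ := hHt
    obtain ⟨jf, hjf⟩ := hHf
    have hex : ∃ j, H j ≠ H j₁ := by
      cases hj : H j₁
      · exact ⟨jt, by rw [hjt]; decide⟩
      · exact ⟨jf, by rw [hjf]; decide⟩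
    obtain ⟨j, hj⟩ := hex
    rcases Finset.mem_union.1 (hcover (s, j) (Or.inl rfl)) with hy | hy
    · obtain ⟨μ, hμ, hyμ⟩ := (mem_vars_iff_mem_support _).1 hy
      exact hj (Hμ μ hμ j (Finsupp.mem_support_iff.1 hyμ))
    · obtain ⟨ν, hν, hyν⟩ := (mem_vars_iff_mem_support _).1 hy
      exact hj (Hν ν hν j (Finsupp.mem_support_iff.1 hyν))

/-! ### Block structure of `M` and the induction step -/

/-- **Rows of a factor living in one block**: if every monomial of `A⁽ᵇ⁾(Mx)` lies in block `c`,
then the rows `(b, ·)` of `M` vanish outside the columns of block `c` (chain rule through the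
injective renaming and independence of the first partials of `A`, Cor. 5.10).
[cite: MediniShpilka2021, proof of Lemma 5.12 (arXiv p0028:L35-L37: "`var(g_i) = var(F_i)`") and Cor 5.10] -/
theorem row_eq_zero_of_support_block (A : MvPolynomial τ K)
    (hAind : ∀ c : τ → K, c ≠ 0 → (∑ j, C (c j) * pderiv j A) ≠ 0)
    (M : Matrix (Fin 4 × τ) (Fin 4 × τ) K) (hM : IsUnit M.det) (b c : Fin 4)
    (hblk : ∀ μ ∈ (aeval (fun v : Fin 4 × τ => ∑ w, C (M v w) * X w)
      (rename (Prod.mk b) A)).support, ∀ w, μ w ≠ 0 → w.1 = c)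
    (j : τ) (y : Fin 4 × τ) (hy : y.1 ≠ c) : M (b, j) y = 0 := by
  set θ := (aeval (fun v : Fin 4 × τ => ∑ w, C (M v w) * X w) :
    MvPolynomial (Fin 4 × τ) K →ₐ[K] MvPolynomial (Fin 4 × τ) K) with hθ
  have hyv : y ∉ (θ (rename (Prod.mk b) A)).vars := by
    intro h
    obtain ⟨μ, hμ, hyμ⟩ := (mem_vars_iff_mem_support y).1 h
    exact hy (hblk μ hμ y (Finsupp.mem_support_iff.1 hyμ))
  have h0 := pderiv_eq_zero_of_notMem_vars hyv
  rw [pderiv_aeval_linSubst (fun v w => M v w) y,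
    ← map_zero (aeval (fun v : Fin 4 × τ => ∑ w, C (M v w) * X w) :
      MvPolynomial (Fin 4 × τ) K →ₐ[K] MvPolynomial (Fin 4 × τ) K)] at h0
  have h1 : (∑ v, C (M v y) * pderiv v (rename (Prod.mk b) A)) = 0 :=
    aeval_linSubst_injective M hM h0
  have h2 : (∑ v, C (M v y) * pderiv v (rename (Prod.mk b) A)) =
      rename (Prod.mk b) (∑ j', C (M (b, j') y) * pderiv j' A) := by
    rw [Fintype.sum_prod_type, Finset.sum_eq_single b]
    · rw [map_sum]
      refine Finset.sum_congr rfl fun j' _ => ?_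
      rw [map_mul, rename_C, pderiv_rename (Prod.mk_right_injective b)]
    · intro b' _ hb'
      refine Finset.sum_eq_zero fun j' _ => ?_
      rw [pderiv_rename_of_notMem_range (Prod.mk b), mul_zero]
      rintro ⟨i, hi⟩
      exact hb' (Prod.mk.inj hi).1.symm
    · intro h; exact absurd (Finset.mem_univ b) h
  rw [h2, ← map_zero (rename (Prod.mk b) : MvPolynomial τ K →ₐ[K] MvPolynomial (Fin 4 × τ) K)]
    at h1
  have h3 := rename_injective _ (Prod.mk_right_injective b) h1
  by_contra hne
  exact hAind (fun j' => M (b, j') y) (fun h => hne (congrFun h j)) h3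

omit [DecidableEq τ] in
/-- **Block form of a factor**: if the rows `(b, ·)` of `M` vanish outside the columns of block
`c`, then `A⁽ᵇ⁾(Mx) = (A(M_b y))⁽ᶜ⁾` with the diagonal block `M_b = (M_{(b,j),(c,j')})`.
[cite: MediniShpilka2021, proof of Lemma 5.12 (arXiv p0028:L38-L40: "apply the induction hypothesis")] -/
theorem aeval_linSubst_rename_eq_rename_block (A : MvPolynomial τ K)
    (M : Matrix (Fin 4 × τ) (Fin 4 × τ) K) (b c : Fin 4)
    (hrow : ∀ j (y : Fin 4 × τ), y.1 ≠ c → M (b, j) y = 0) :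
    aeval (fun v : Fin 4 × τ => ∑ w, C (M v w) * X w) (rename (Prod.mk b) A) =
      rename (Prod.mk c) (aeval (fun j : τ => ∑ j', C (M (b, j) (c, j')) * X j') A) := by
  rw [aeval_rename, ← AlgHom.comp_apply, comp_aeval]
  have hfg : ((fun v : Fin 4 × τ => ∑ w, C (M v w) * X w) ∘ Prod.mk b) =
      fun j : τ => rename (Prod.mk c) (∑ j', C (M (b, j) (c, j')) * X j' : MvPolynomial τ K) := by
    funext j
    simp only [Function.comp_apply, map_sum, map_mul, rename_C, rename_X]
    rw [Fintype.sum_prod_type, Finset.sum_eq_single c]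
    · intro b' _ hb'
      refine Finset.sum_eq_zero fun j' _ => ?_
      rw [hrow j (b', j') hb', C_0, zero_mul]
    · intro h; exact absurd (Finset.mem_univ c) h
  rw [hfg]

omit [Fintype τ] in
/-- **Monomials of the diagonal block substitution**: with `P₀ = R⁽ᶜ⁾` living in block `c`, its
partner `P₁ ≠ 0` in block `1 - c`, and all `μ + ν` (`μ ∈ mon P₀`, `ν ∈ mon P₁`) monomials of `B`,
the monomials of `R` are monomials of `A` ("`mon(g_i) ⊆ mon(F_i)`" by restricting monomials).
[cite: MediniShpilka2021, proof of Lemma 5.12 (arXiv p0028:L38-L40)] -/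
theorem support_subset_of_rename_eq (A : MvPolynomial τ K) {d : ℕ} (hd0 : d ≠ 0)
    {B : MvPolynomial (Fin 4 × τ) K}
    (hB : B = rename (Prod.mk (0 : Fin 4)) A * rename (Prod.mk (1 : Fin 4)) A +
      rename (Prod.mk (2 : Fin 4)) A * rename (Prod.mk (3 : Fin 4)) A)
    {P₀ P₁ : MvPolynomial (Fin 4 × τ) K}
    (hpair : ∀ μ ∈ P₀.support, ∀ ν ∈ P₁.support, μ + ν ∈ B.support) (hP₁ : P₁ ≠ 0)
    {c : Fin 4} (hc₀ : ∀ μ ∈ P₀.support, ∀ w, μ w ≠ 0 → w.1 = c)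
    (hc₁ : ∀ ν ∈ P₁.support, ∀ w, ν w ≠ 0 → w.1 = 1 - c) (h₀ : P₀.IsHomogeneous d)
    {R : MvPolynomial τ K} (hR : rename (Prod.mk c) R = P₀) : R.support ⊆ A.support := by
  intro ρ hρ
  have hμ : Finsupp.mapDomain (Prod.mk c) ρ ∈ P₀.support := by
    rw [← hR, support_rename_of_injective (Prod.mk_right_injective c), Finset.mem_image]
    exact ⟨ρ, hρ, rfl⟩
  set μ := Finsupp.mapDomain (Prod.mk c) ρ with hμdef
  obtain ⟨ν, hν⟩ := Finset.nonempty_of_ne_empty (mt support_eq_empty.1 hP₁)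
  have hm := hpair μ hμ ν hν
  rw [hB] at hm
  -- a variable of `μ` in block `c`
  have hμ0 : μ ≠ 0 := by
    intro h
    refine mem_support_iff.1 hμ (h₀.coeff_eq_zero ?_)
    rw [h, map_zero]; exact hd0.symm
  obtain ⟨w, hw⟩ := Finsupp.ne_iff.1 hμ0
  have hw' : μ w ≠ 0 := hw
  have hwc : w = (c, w.2) := Prod.ext (hc₀ μ hμ w hw') rfl
  have hj₀ : (μ + ν) (c, w.2) ≠ 0 := by
    rw [Finsupp.add_apply, ← hwc]; omega
  obtain ⟨μ', hμ', ν', -, hdec⟩ := exists_decomp_of_mem_support_block_of_ne_zero A hm hj₀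
  have key : ρ = μ' := by
    ext j
    have e1 : μ (c, j) = ρ j := Finsupp.mapDomain_apply (Prod.mk_right_injective c) ρ j
    have e2 : ν (c, j) = 0 := by
      by_contra h
      exact one_sub_ne_self c (hc₁ ν hν (c, j) h).symm
    have e3 := congrArg (fun f : Fin 4 × τ →₀ ℕ => f (c, j)) hdec
    simp only [Finsupp.add_apply] at e3
    rw [e2, add_zero, e1, Finsupp.mapDomain_apply (Prod.mk_right_injective c),
      Finsupp.mapDomain_notin_range] at e3
    · rw [e3, add_zero]
    · rintro ⟨i, hi⟩
      exact one_sub_ne_self c (Prod.mk.inj hi).1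
  rw [key]
  exact hμ'

/-- **The diagonal blocks of a block-monomial invertible matrix are invertible.**
[cite: MediniShpilka2021, proof of Lemma 5.12 (arXiv p0028:L10-L12: "the `4^Δ` linear functions … linearly independent")] -/
theorem isUnit_det_block (M : Matrix (Fin 4 × τ) (Fin 4 × τ) K) (hM : IsUnit M.det)
    (σf : Fin 4 → Fin 4) (hσ : Function.Injective σf)
    (hrows : ∀ b j (y : Fin 4 × τ), y.1 ≠ σf b → M (b, j) y = 0) (b : Fin 4) :
    IsUnit (Matrix.of fun j j' : τ => M (b, j) (σf b, j')).det := by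
  set Mb : Matrix τ τ K := Matrix.of fun j j' : τ => M (b, j) (σf b, j') with hMb
  rw [← Matrix.isUnit_iff_isUnit_det, ← Matrix.mulVec_injective_iff_isUnit]
  -- kernel of `Mb` is trivial
  have hker : ∀ v : τ → K, Mb *ᵥ v = 0 → v = 0 := by
    intro v hv
    set V : Fin 4 × τ → K := fun w => if w.1 = σf b then v w.2 else 0 with hV
    have hMV : M *ᵥ V = 0 := by
      funext ⟨b', j⟩
      rw [Pi.zero_apply, Matrix.mulVec, dotProduct, Fintype.sum_prod_type,
        Finset.sum_eq_single (σf b)]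
      · by_cases hb' : b' = b
        · subst hb'
          have := congrFun hv j
          rw [Pi.zero_apply, Matrix.mulVec, dotProduct] at this
          rw [← this]
          refine Finset.sum_congr rfl fun j' _ => ?_
          simp only [hV, if_pos rfl, hMb, Matrix.of_apply]
        · refine Finset.sum_eq_zero fun j' _ => ?_
          rw [hrows b' j (σf b, j') (fun h => hb' (hσ h.symm)), zero_mul]
      · intro b'' _ hb''
        refine Finset.sum_eq_zero fun j' _ => ?_
        simp only [hV, if_neg hb'', mul_zero]
      · intro h; exact absurd (Finset.mem_univ _) h
    have hV0 : V = 0 := Matrix.eq_zero_of_mulVec_eq_zero hM.ne_zero hMV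
    funext j
    have := congrFun hV0 (σf b, j)
    simp only [hV, if_pos rfl, Pi.zero_apply] at this
    exact this
  intro v₁ v₂ h
  have : Mb *ᵥ (v₁ - v₂) = 0 := by rw [Matrix.mulVec_sub, h, sub_self]
  exact sub_eq_zero.1 (hker _ this)

/-- Re-indexing the two products of `B` along a block bijection compatible with the sibling map
does not change `B` (commutativity): the explicit form of the `TR`-symmetry "WLOG"s.
[cite: MediniShpilka2021, §2 (defTR, arXiv p0014-p0015) and proof of Lemma 5.12 (p0028:L38-L40)] -/
theorem pair_sum_eq {R : Type*} [CommSemiring R] (P : Fin 4 → R) (e : Fin 4 → Fin 4)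
    (he : Function.Injective e) (hpair : ∀ b, e (1 - b) = 1 - e b) :
    P (e 0) * P (e 1) + P (e 2) * P (e 3) = P 0 * P 1 + P 2 * P 3 := by
  have h1 : e 1 = 1 - e 0 := by have := hpair 0; rwa [sub_zero] at this
  have h3 : e 3 = 1 - e 2 := by
    have := hpair 2; rwa [show (1 : Fin 4) - 2 = 3 from by decide] at this
  have hne : e 0 ≠ e 2 := fun h => absurd (he h) (by decide)
  have hne' : e 1 ≠ e 2 := fun h => absurd (he h) (by decide)
  rw [h1] at hne'
  rw [h1, h3]
  have four : ∀ x : Fin 4, x = 0 ∨ x = 1 ∨ x = 2 ∨ x = 3 := by decide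
  have e12 : (1 : Fin 4) - 2 = 3 := by decide
  have e13 : (1 : Fin 4) - 3 = 2 := by decide
  generalize e 0 = a at *
  generalize e 2 = c at *
  rcases four a with rfl | rfl | rfl | rfl <;> rcases four c with rfl | rfl | rfl | rfl <;>
    first
    | (exfalso; revert hne hne'; decide)
    | (simp only [sub_zero, sub_self, e12, e13]; done)
    | (simp only [sub_zero, sub_self, e12, e13]; ring)

/-- **Lemma 5.12, induction step on blocks (TR-free form).** Let `A` be multilinear, homogeneous
of degree `d ≥ 2`, with the sibling property, independent first partials and the "halves"
property `H`, and suppose the TR-free Lemma 5.12 holds for `A`: `mon(A(M₀y)) ⊆ mon(A)` forces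
`A(M₀y) = A(α₀ • y)`.  Then for `B = A⁽⁰⁾A⁽¹⁾ + A⁽²⁾A⁽³⁾` (with independent first partials) and
every invertible `M` with `mon(B(Mx)) ⊆ mon(B)` there are nonzero scalars `α` with
`B(Mx) = B(α • x)`.  (Printed: "apply the induction hypothesis and conclude … up to `TR`
symmetry"; the symmetry is the block bijection `σ`, absorbed by commutativity.)
[cite: MediniShpilka2021, Lemma 5.12 and its proof, induction step (arXiv p0028:L7-L40)] -/
theorem block_step (A : MvPolynomial τ K) {d : ℕ} (hAd : A.IsHomogeneous d) (hd : 2 ≤ d)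
    (hA0 : A ≠ 0) (hA1 : ∀ j, degreeOf j A ≤ 1)
    (hAsib : ∀ j : τ, ∃ j' : τ, j' ≠ j ∧ ∀ μ ∈ A.support, μ j ≠ 0 → μ j' ≠ 0)
    (hAind : ∀ c : τ → K, c ≠ 0 → (∑ j, C (c j) * pderiv j A) ≠ 0)
    (H : τ → Bool) (hH : ∀ μ ∈ A.support, ∀ j j', μ j ≠ 0 → μ j' ≠ 0 → H j = H j')
    (hHt : ∃ j, H j = true) (hHf : ∃ j, H j = false)
    (hIH : ∀ M₀ : Matrix τ τ K, IsUnit M₀.det →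
      (aeval (fun j : τ => ∑ j', C (M₀ j j') * X j') A).support ⊆ A.support →
      ∃ α₀ : τ → K, (∀ j, α₀ j ≠ 0) ∧
        aeval (fun j : τ => ∑ j', C (M₀ j j') * X j') A = aeval (fun j => C (α₀ j) * X j) A)
    {B : MvPolynomial (Fin 4 × τ) K}
    (hB : B = rename (Prod.mk (0 : Fin 4)) A * rename (Prod.mk (1 : Fin 4)) A +
      rename (Prod.mk (2 : Fin 4)) A * rename (Prod.mk (3 : Fin 4)) A)
    (hBind : ∀ u : Fin 4 × τ → K, u ≠ 0 → (∑ v, C (u v) * pderiv v B) ≠ 0)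
    (M : Matrix (Fin 4 × τ) (Fin 4 × τ) K) (hM : IsUnit M.det)
    (hsupp : (aeval (fun v : Fin 4 × τ => ∑ w, C (M v w) * X w) B).support ⊆ B.support) :
    ∃ α : Fin 4 × τ → K, (∀ v, α v ≠ 0) ∧
      aeval (fun v : Fin 4 × τ => ∑ w, C (M v w) * X w) B = aeval (fun v => C (α v) * X v) B := by
  set θ := (aeval (fun v : Fin 4 × τ => ∑ w, C (M v w) * X w) :
    MvPolynomial (Fin 4 × τ) K →ₐ[K] MvPolynomial (Fin 4 × τ) K) with hθ
  set G : Fin 4 → MvPolynomial (Fin 4 × τ) K := fun b => θ (rename (Prod.mk b) A) with hG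
  have hd0 : d ≠ 0 := by omega
  have four : ∀ x : Fin 4, x = 0 ∨ x = 1 ∨ x = 2 ∨ x = 3 := by decide
  have e12 : (1 : Fin 4) - 2 = 3 := by decide
  have e13 : (1 : Fin 4) - 3 = 2 := by decide
  -- basic facts on the factors
  have hG0 : ∀ b, G b ≠ 0 := by
    intro b h
    have h' : θ (rename (Prod.mk b) A) = θ 0 := by rw [map_zero]; exact h
    have h1 : rename (Prod.mk b) A = 0 := aeval_linSubst_injective M hM h'
    rw [← map_zero (rename (Prod.mk b) : MvPolynomial τ K →ₐ[K] MvPolynomial (Fin 4 × τ) K)] at h1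
    exact hA0 (rename_injective _ (Prod.mk_right_injective b) h1)
  have hGhom : ∀ b, (G b).IsHomogeneous d := fun b =>
    isHomogeneous_aeval_linSubst M hAd.rename_isHomogeneous
  have hθB : θ B = G 0 * G 1 + G 2 * G 3 := by
    rw [hB, map_add, map_mul, map_mul]
  -- the two products are supported on `mon B`
  have hS01 : (G 0 * G 1).support ⊆ B.support := by
    have := support_aeval_linSubst_mul_subset A hAd hd hA1 hAsib hB hBind M hM hsupp
      (Or.inl ⟨rfl, rfl⟩)
    rwa [map_mul] at this
  have hS23 : (G 2 * G 3).support ⊆ B.support := by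
    have := support_aeval_linSubst_mul_subset A hAd hd hA1 hAsib hB hBind M hM hsupp
      (Or.inr ⟨rfl, rfl⟩)
    rwa [map_mul] at this
  have hB1 : ∀ m ∈ B.support, ∀ v, m v ≤ 1 := fun m hm v =>
    block_support_le_one A hA1 (hB ▸ hm) v
  have hdis01 : Disjoint (G 0).vars (G 1).vars :=
    disjoint_vars_of_degreeOf_mul_le_one (hG0 0) (hG0 1)
      (degreeOf_le_one_of_support fun m hm v => hB1 m (hS01 hm) v)
  have hdis23 : Disjoint (G 2).vars (G 3).vars :=
    disjoint_vars_of_degreeOf_mul_le_one (hG0 2) (hG0 3)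
      (degreeOf_le_one_of_support fun m hm v => hB1 m (hS23 hm) v)
  -- sides of the two products
  obtain ⟨s, hs, hside01⟩ := exists_side_of_support_mul_subset A hB hd0 (hGhom 0) (hGhom 1)
    (hG0 0) (hG0 1) hdis01 hS01
  obtain ⟨s', hs', hside23⟩ := exists_side_of_support_mul_subset A hB hd0 (hGhom 2) (hGhom 3)
    (hG0 2) (hG0 3) hdis23 hS23
  have hvarsB : ∀ y, y ∈ (G 0).vars ∪ (G 1).vars ∨ y ∈ (G 2).vars ∪ (G 3).vars := by
    intro y
    have hy := mem_vars_aeval_linSubst_of_indep hBind M hM y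
    rw [hθB] at hy
    rcases Finset.mem_union.1 (vars_add_subset _ _ hy) with h | h
    · exact Or.inl (vars_mul _ _ h)
    · exact Or.inr (vars_mul _ _ h)
  obtain ⟨jt, hjt⟩ := hHt
  have hss' : s' ≠ s := by
    intro hss
    rw [hss] at hside23
    rcases hvarsB (s + 2, jt) with h | h
    · rcases hside01 _ h with h' | h' <;> rcases hs with rfl | rfl <;>
        (dsimp only at h'; exact absurd h' (by decide))
    · rcases hside23 _ h with h' | h' <;> rcases hs with rfl | rfl <;>
        (dsimp only at h'; exact absurd h' (by decide))
  have hcover01 : ∀ y : Fin 4 × τ, (y.1 = s ∨ y.1 = 1 - s) → y ∈ (G 0).vars ∪ (G 1).vars := by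
    intro y hy
    rcases hvarsB y with h | h
    · exact h
    · exfalso
      have h' := hside23 y h
      rcases hs with rfl | rfl <;> rcases hs' with rfl | rfl <;>
        first
        | exact hss' rfl
        | (rcases hy with h1 | h1 <;> rcases h' with h2 | h2 <;> (rw [h1] at h2; revert h2; decide))
  have hcover23 : ∀ y : Fin 4 × τ, (y.1 = s' ∨ y.1 = 1 - s') → y ∈ (G 2).vars ∪ (G 3).vars := by
    intro y hy
    rcases hvarsB y with h | h
    · exfalso
      have h' := hside01 y h
      rcases hs with rfl | rfl <;> rcases hs' with rfl | rfl <;>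
        first
        | exact hss' rfl
        | (rcases hy with h1 | h1 <;> rcases h' with h2 | h2 <;> (rw [h1] at h2; revert h2; decide))
    · exact h
  -- each factor lives in one block
  obtain ⟨c₀, hc₀, hblk0, hblk1⟩ := exists_block_of_support_mul_subset A hAd hd H hH ⟨jt, hjt⟩ hHf
    hB (hGhom 0) (hGhom 1) (hG0 0) (hG0 1) hdis01 hS01 hside01 hcover01
  obtain ⟨c₂, hc₂, hblk2, hblk3⟩ := exists_block_of_support_mul_subset A hAd hd H hH ⟨jt, hjt⟩ hHf
    hB (hGhom 2) (hGhom 3) (hG0 2) (hG0 3) hdis23 hS23 hside23 hcover23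
  -- the block bijection
  obtain ⟨σf, hσf0, hσf1, hσf2, hσf3, hσinj⟩ : ∃ σf : Fin 4 → Fin 4, σf 0 = c₀ ∧ σf 1 = 1 - c₀ ∧
      σf 2 = c₂ ∧ σf 3 = 1 - c₂ ∧ Function.Injective σf := by
    refine ⟨![c₀, 1 - c₀, c₂, 1 - c₂], rfl, rfl, rfl, rfl, ?_⟩
    rcases hs with rfl | rfl <;> rcases hs' with rfl | rfl <;> rcases hc₀ with rfl | rfl <;>
      rcases hc₂ with rfl | rfl <;> first | exact absurd rfl hss' | decide
  have hpairσ : ∀ b, σf (1 - b) = 1 - σf b := by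
    intro b
    rcases four b with rfl | rfl | rfl | rfl
    · rw [sub_zero, hσf1, hσf0]
    · rw [sub_self, hσf0, hσf1, sub_sub_cancel]
    · rw [e12, hσf3, hσf2]
    · rw [e13, hσf2, hσf3, sub_sub_cancel]
  have hblk : ∀ b, ∀ μ ∈ (G b).support, ∀ w, μ w ≠ 0 → w.1 = σf b := by
    intro b
    rcases four b with rfl | rfl | rfl | rfl
    · rw [hσf0]; exact hblk0
    · rw [hσf1]; exact hblk1
    · rw [hσf2]; exact hblk2
    · rw [hσf3]; exact hblk3
  -- rows and diagonal blocks of `M`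
  have hrows : ∀ b j (y : Fin 4 × τ), y.1 ≠ σf b → M (b, j) y = 0 := fun b j y hy =>
    row_eq_zero_of_support_block A hAind M hM b (σf b) (hblk b) j y hy
  set Mb : Fin 4 → Matrix τ τ K := fun b => Matrix.of fun j j' : τ => M (b, j) (σf b, j')
    with hMb
  have hGb : ∀ b, G b = rename (Prod.mk (σf b))
      (aeval (fun j : τ => ∑ j', C (Mb b j j') * X j') A) := fun b =>
    aeval_linSubst_rename_eq_rename_block A M b (σf b) fun j y hy => hrows b j y hy
  have hMbdet : ∀ b, IsUnit (Mb b).det := fun b => isUnit_det_block M hM σf hσinj hrows b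
  -- monomial pairs across sibling factors
  have hpairs : ∀ b, ∀ μ ∈ (G b).support, ∀ ν ∈ (G (1 - b)).support, μ + ν ∈ B.support := by
    have key01 : ∀ μ ∈ (G 0).support, ∀ ν ∈ (G 1).support, μ + ν ∈ B.support := fun μ hμ ν hν =>
      hS01 ((mem_support_mul_iff_of_vars_subset (Finset.Subset.refl _)
        (fun i hi hi' => Finset.disjoint_left.1 hdis01 hi' hi) _).2 ⟨μ, hμ, ν, hν, rfl⟩)
    have key23 : ∀ μ ∈ (G 2).support, ∀ ν ∈ (G 3).support, μ + ν ∈ B.support := fun μ hμ ν hν =>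
      hS23 ((mem_support_mul_iff_of_vars_subset (Finset.Subset.refl _)
        (fun i hi hi' => Finset.disjoint_left.1 hdis23 hi' hi) _).2 ⟨μ, hμ, ν, hν, rfl⟩)
    intro b
    rcases four b with rfl | rfl | rfl | rfl <;> intro μ hμ ν hν
    · rw [sub_zero] at hν; exact key01 μ hμ ν hν
    · rw [sub_self] at hν; rw [add_comm]; exact key01 ν hν μ hμ
    · rw [e12] at hν; exact key23 μ hμ ν hν
    · rw [e13] at hν; rw [add_comm]; exact key23 ν hν μ hμ
  have hsuppb : ∀ b, (aeval (fun j : τ => ∑ j', C (Mb b j j') * X j') A).support ⊆ A.support := by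
    intro b
    refine support_subset_of_rename_eq A hd0 hB (hpairs b) (hG0 (1 - b)) (hblk b) ?_ (hGhom b)
      (hGb b).symm
    intro ν hν w hw
    rw [← hpairσ b]
    exact hblk (1 - b) ν hν w hw
  -- the induction hypothesis, blockwise
  have hex : ∀ b, ∃ α₀ : τ → K, (∀ j, α₀ j ≠ 0) ∧
      aeval (fun j : τ => ∑ j', C (Mb b j j') * X j') A = aeval (fun j => C (α₀ j) * X j) A :=
    fun b => hIH (Mb b) (hMbdet b) (hsuppb b)
  choose αb hαb0 hαb using hex
  -- assembling `α` along the inverse block bijection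
  have hσbij : Function.Bijective σf := ⟨hσinj, Finite.surjective_of_injective hσinj⟩
  set e := Equiv.ofBijective σf hσbij with he
  have heσ : ∀ b, e.symm (σf b) = b := fun b => Equiv.ofBijective_symm_apply_apply σf hσbij b
  have hσe : ∀ b, σf (e.symm b) = b := fun b => Equiv.ofBijective_apply_symm_apply σf hσbij b
  have hpaire : ∀ b, e.symm (1 - b) = 1 - e.symm b := by
    intro b
    apply hσinj
    rw [hσe, hpairσ, hσe]
  refine ⟨fun w => αb (e.symm w.1) w.2, fun w => hαb0 _ _, ?_⟩
  have hD : ∀ b', aeval (fun v : Fin 4 × τ => C (αb (e.symm v.1) v.2) * X v)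
      (rename (Prod.mk b') A) = G (e.symm b') := by
    intro b'
    have hfg : ((fun v : Fin 4 × τ => C (αb (e.symm v.1) v.2) * X v) ∘ Prod.mk b') =
        fun j : τ => rename (Prod.mk b') (C (αb (e.symm b') j) * X j : MvPolynomial τ K) := by
      funext j
      simp only [Function.comp_apply, map_mul, rename_C, rename_X]
    rw [aeval_rename, hfg, hGb (e.symm b'), hαb (e.symm b'), hσe, ← AlgHom.comp_apply, comp_aeval]
  calc θ B = G 0 * G 1 + G 2 * G 3 := hθB
    _ = G (e.symm 0) * G (e.symm 1) + G (e.symm 2) * G (e.symm 3) :=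
        (pair_sum_eq G e.symm e.symm.injective hpaire).symm
    _ = aeval (fun v : Fin 4 × τ => C (αb (e.symm v.1) v.2) * X v) B := by
        rw [hB, map_add, map_mul, map_mul, hD, hD, hD, hD]

end MS2021

end Literature.Computability.AlgebraicComplexity

end
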